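import Summits.KontsevichZagierPeriods.KontsevichZagierPeriods.Theses.ScissorsTransport
import Summits.KontsevichZagierPeriods.KontsevichZagierPeriods.Theorems.ScissorsTransportDimOneTransportFailsKit
import Summits.KontsevichZagierPeriods.KontsevichZagierPeriods.Theorems.SymplecticScissorsPlanarCompilerStubElementaryMovesAux
import Literature.NumberTheory.Transcendental.KZIntervalPeriodProofs

/-!
# Route ScissorsTransport — `DimOneTransportFails`: stabilisation is necessary in dimension one

Problem `KontsevichZagierPeriods`, route `ScissorsTransport`, support item
stmt-KontsevichZagierPeriods-2671 (`DimOneTransportFails`: the free dimension `M ≥ 1` of the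
thesis `StableSetTransport` is load-bearing). Proved as stated with the witness pair
`r = [(1,2), 1]`, `r' = [(1,2), g]`, `g = 1 + 1/x − 1/(3 − x)` (rational, `g ≥ 1/2 > 0`, both of
value `1` as `∫₁² dx/x = ∫₁² dx/(3 − x) = log 2`): `Equivalent r r'` by three honest moves — rule
(1b) twice and ONE change of variables, the reflection `y = 3 − x` of `(1, 2)`; and NO single
change-of-variables instance between full-measure restrictions `s ⊆ r`, `s' ⊆ r'` — such a
membership pins (free group; `s ≠ s'` as the integrands agree only at `3/2`) an injective
`ℚ`-semialgebraic `Φ` on `s.domain`, differentiable within it, with `1 = g(Φ x) |Φ' x|`; on an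
open interval inside `s.domain` (a non-null semialgebraic subset of the line contains one) the
sign of `Φ'` is constant (Darboux), so `(−Φ² + Φ + 3) Φ' = ε Φ (3 − Φ)`: the inverse of `Φ` is a
primitive of the rational function `ε g(y)`, simple pole of residue `ε` at `y = 0` (it is
`ε (y + log y + log (3 − y)) + c`); semialgebraicity gives `P ≠ 0` with `P(Φ t, t) = 0`, and the
swapped simple-pole descent of the kit (`DimOneTransportFailsKit`, the one-variable technique of
the barrier `AlgebraicPrimitivesObstruction`) forces `P = 0`.

Definition-free: the interval `(1,2) ⊆ ℝ¹` is written `(fun x => x 0) ⁻¹' Ioo 1 2` throughout and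
the five representations are produced by `exists_lineRep`. Sources: Kontsevich–Zagier 2001 §1.2
(rules 1b, 2); Cresson–Viu-Sos 2022 §2.1–2.2; hub triage of card newton-leibniz-is-a-shear (the
log obstruction). NOT here: KZ's second witness (arcsin obstruction), the `M = 1` repair.
-/

noncomputable section

open Set MeasureTheory MvPolynomial Filter Topology
open Literature.NumberTheory.Transcendental Literature.ModelTheory.ExponentialFields
open Summit.KontsevichZagierPeriods.ScissorsTransport.DimOneTransportFailsKit
open Summit.KontsevichZagierPeriods.SymplecticScissors.PlanarK0InjectiveNegative
  (eq_of_of_sub_of_eq)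
open Summit.KontsevichZagierPeriods.SymplecticScissors.PlanarCompilerProof.ElementaryMoves
  (det_eq_apply single_eq_one)

namespace Summit.KontsevichZagierPeriods.ScissorsTransport

/-! ## §1 The interval `(1, 2) ⊆ ℝ¹` and honest representations over it -/

/-- `(1, 2) ⊆ ℝ¹` is `ℚ`-semialgebraic. [folklore] -/
theorem isSemialgebraic_I12 : IsSemialgebraic ℚ ((fun x : Fin 1 → ℝ => x 0) ⁻¹' Ioo 1 2) := by
  have h1 := isSemialgebraic_setOf_eval_lt (k := ℚ) (R := ℝ) (1 : MvPolynomial (Fin 1) ℚ) (X 0)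
  have h2 := isSemialgebraic_setOf_eval_lt (k := ℚ) (R := ℝ) (X 0 : MvPolynomial (Fin 1) ℚ) 2
  simp only [aeval_X, map_one] at h1
  simp only [aeval_X, map_ofNat] at h2
  have hset : ((fun x : Fin 1 → ℝ => x 0) ⁻¹' Ioo 1 2) =
      {x : Fin 1 → ℝ | 1 < x 0} ∩ {x | x 0 < 2} := by
    ext x
    simp only [mem_preimage, mem_Ioo, mem_inter_iff, mem_setOf_eq]
  rw [hset]
  exact h1.inter h2

/-- `(1, 2) ⊆ ℝ¹` (open, non-empty) has non-zero Lebesgue measure. [folklore] -/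
theorem volume_I12_ne_zero : volume ((fun x : Fin 1 → ℝ => x 0) ⁻¹' Ioo 1 2) ≠ 0 :=
  ((isOpen_Ioo.preimage (continuous_apply 0)).measure_pos volume
    ⟨fun _ => 3 / 2, by norm_num⟩).ne'

/-- `(1, 2) ⊆ ℝ¹` lies in the compact box `[1, 2]`. [folklore] -/
theorem I12_subset_Icc :
    ((fun x : Fin 1 → ℝ => x 0) ⁻¹' Ioo 1 2) ⊆ Icc (fun _ => (1 : ℝ)) (fun _ => 2) :=
  fun x hx => ⟨fun i => by rw [Subsingleton.elim i 0]; exact hx.1.le,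
    fun i => by rw [Subsingleton.elim i 0]; exact hx.2.le⟩

/-- **Honest one-variable representations over `(1, 2)`.** A function `f`, `ℚ`-semialgebraic on
`(1, 2)` (as `x ↦ f (x 0)`) and continuous on `[1, 2]`, is the integrand of an integral
representation with domain `(1, 2) ⊆ ℝ¹` (absolute integrability from continuity on the compact
box). [Kontsevich–Zagier 2001, §1.1] [folklore] -/
theorem exists_lineRep (f : ℝ → ℝ)
    (hsa : IsSemialgebraicFunOn ℚ ((fun x : Fin 1 → ℝ => x 0) ⁻¹' Ioo 1 2) (fun x => f (x 0)))
    (hcont : ContinuousOn f (Icc 1 2)) :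
    ∃ r : KZ.IntegralRep 1,
      r.domain = ((fun x : Fin 1 → ℝ => x 0) ⁻¹' Ioo 1 2) ∧ ∀ x, r.integrand x = f (x 0) := by
  have hK : IsCompact (Icc (fun _ : Fin 1 => (1 : ℝ)) (fun _ => 2)) := isCompact_Icc
  have hc : ContinuousOn (fun x : Fin 1 → ℝ => f (x 0))
      (Icc (fun _ : Fin 1 => (1 : ℝ)) (fun _ => 2)) :=
    hcont.comp (continuous_apply 0).continuousOn fun x hx => ⟨hx.1 0, hx.2 0⟩
  exact ⟨⟨((fun x : Fin 1 → ℝ => x 0) ⁻¹' Ioo 1 2), fun x => f (x 0), isSemialgebraic_I12, hsa,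
    (hc.integrableOn_compact hK).mono_set I12_subset_Icc⟩, rfl, fun _ => rfl⟩

/-- Quotients of rational polynomials are `ℚ`-semialgebraic functions on `(1, 2)` (no
Tarski–Seidenberg: `isSemialgebraicFunOn_aeval_div_aeval`). [folklore] -/
theorem sa_of_eq_div (p q : MvPolynomial (Fin 1) ℚ) (f : ℝ → ℝ)
    (hq : ∀ x ∈ ((fun x : Fin 1 → ℝ => x 0) ⁻¹' Ioo 1 2), aeval x q ≠ 0)
    (hf : ∀ x ∈ ((fun x : Fin 1 → ℝ => x 0) ⁻¹' Ioo 1 2), aeval x p / aeval x q = f (x 0)) :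
    IsSemialgebraicFunOn ℚ ((fun x : Fin 1 → ℝ => x 0) ⁻¹' Ioo 1 2) (fun x => f (x 0)) :=
  (isSemialgebraicFunOn_aeval_div_aeval isSemialgebraic_I12 p q hq).congr fun x hx => hf x hx

/-- `x ↦ 1 + 1/x − 1/(3 − x)` is `ℚ`-semialgebraic on `(1, 2)`. [folklore] -/
theorem sa_g :
    IsSemialgebraicFunOn ℚ ((fun x : Fin 1 → ℝ => x 0) ⁻¹' Ioo 1 2)
      (fun x => 1 + 1 / x 0 - 1 / (3 - x 0)) := by
  refine sa_of_eq_div (-(X 0) ^ 2 + X 0 + 3) (X 0 * (3 - X 0)) (fun y => 1 + 1 / y - 1 / (3 - y))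
    (fun x hx => ?_) (fun x hx => ?_)
  · obtain ⟨h1, h2⟩ : (0 : ℝ) < x 0 ∧ (0 : ℝ) < 3 - x 0 := ⟨by linarith [hx.1], by linarith [hx.2]⟩
    simp only [map_mul, map_sub, aeval_X, map_ofNat]
    positivity
  · obtain ⟨h1, h2⟩ : (x 0 : ℝ) ≠ 0 ∧ (3 : ℝ) - x 0 ≠ 0 := ⟨by linarith [hx.1], by linarith [hx.2]⟩
    simp only [map_mul, map_sub, map_add, map_neg, map_pow, aeval_X, map_ofNat]
    field_simp
    ring

/-- `x ↦ 1/x − 1/(3 − x)` is `ℚ`-semialgebraic on `(1, 2)`. [folklore] -/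
theorem sa_d :
    IsSemialgebraicFunOn ℚ ((fun x : Fin 1 → ℝ => x 0) ⁻¹' Ioo 1 2)
      (fun x => 1 / x 0 - 1 / (3 - x 0)) := by
  refine sa_of_eq_div (3 - 2 * X 0) (X 0 * (3 - X 0)) (fun y => 1 / y - 1 / (3 - y))
    (fun x hx => ?_) (fun x hx => ?_)
  · obtain ⟨h1, h2⟩ : (0 : ℝ) < x 0 ∧ (0 : ℝ) < 3 - x 0 := ⟨by linarith [hx.1], by linarith [hx.2]⟩
    simp only [map_mul, map_sub, aeval_X, map_ofNat]
    positivity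
  · obtain ⟨h1, h2⟩ : (x 0 : ℝ) ≠ 0 ∧ (3 : ℝ) - x 0 ≠ 0 := ⟨by linarith [hx.1], by linarith [hx.2]⟩
    simp only [map_mul, map_sub, aeval_X, map_ofNat]
    field_simp
    ring

/-- `x ↦ 1/x` is `ℚ`-semialgebraic on `(1, 2)`. [folklore] -/
theorem sa_h :
    IsSemialgebraicFunOn ℚ ((fun x : Fin 1 → ℝ => x 0) ⁻¹' Ioo 1 2) (fun x => 1 / x 0) := by
  refine sa_of_eq_div 1 (X 0) (fun y => 1 / y) (fun x hx => ?_) (fun x hx => ?_)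
  · have h1 : (0 : ℝ) < x 0 := by linarith [hx.1]
    simp only [aeval_X]
    positivity
  · simp only [map_one, aeval_X]

/-- `x ↦ 1/(3 − x)` is `ℚ`-semialgebraic on `(1, 2)`. [folklore] -/
theorem sa_k :
    IsSemialgebraicFunOn ℚ ((fun x : Fin 1 → ℝ => x 0) ⁻¹' Ioo 1 2) (fun x => 1 / (3 - x 0)) := by
  refine sa_of_eq_div 1 (3 - X 0) (fun y => 1 / (3 - y)) (fun x hx => ?_) (fun x hx => ?_)
  · have h2 : (0 : ℝ) < 3 - x 0 := by linarith [hx.2]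
    simp only [map_sub, aeval_X, map_ofNat]
    positivity
  · simp only [map_one, map_sub, aeval_X, map_ofNat]

/-! ## §2 The three honest moves -/

/-- **The reflection `y = 3 − x` of `(1, 2)` is one change-of-variables move**
`[(1,2), 1/x] − [(1,2), 1/(3 − y)] ∈ changeOfVariablesRel` (`Φ x = 3 − x`, `Φ' = −id`,
`|det Φ'| = 1`, `1/x = 1/(3 − (3 − x)) · 1`). [Kontsevich–Zagier 2001, §1.2, rule (2)]
[folklore] -/
theorem reflection_mem_changeOfVariablesRel {r r' : KZ.IntegralRep 1}
    (hr : r.domain = ((fun x : Fin 1 → ℝ => x 0) ⁻¹' Ioo 1 2))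
    (hr' : r'.domain = ((fun x : Fin 1 → ℝ => x 0) ⁻¹' Ioo 1 2))
    (hri : ∀ x, r.integrand x = 1 / x 0) (hr'i : ∀ x, r'.integrand x = 1 / (3 - x 0)) :
    KZ.of r - KZ.of r' ∈ KZ.changeOfVariablesRel := by
  refine ⟨1, r, r', fun x => (fun _ : Fin 1 => (3 : ℝ)) - x,
    fun _ => -ContinuousLinearMap.id ℝ (Fin 1 → ℝ), ?_, ?_, ?_, ?_, ?_, rfl⟩
  · rw [hr]
    convert isSemialgebraicMapOn_aeval isSemialgebraic_I12
      (fun j : Fin 1 => (3 : MvPolynomial (Fin 1) ℚ) - X j) using 2 with x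
    funext j
    simp
  · intro x _
    exact ((hasFDerivAt_id x).const_sub (fun _ : Fin 1 => (3 : ℝ))).hasFDerivWithinAt
  · intro x _ y _ hxy
    have h := congrFun hxy 0
    simp only [Pi.sub_apply] at h
    funext i
    rw [Subsingleton.elim i 0]
    linarith
  · rw [hr, hr']
    ext y
    simp only [mem_preimage, mem_Ioo, mem_image]
    constructor
    · rintro ⟨h1, h2⟩
      refine ⟨(fun _ : Fin 1 => (3 : ℝ)) - y, ⟨?_, ?_⟩, ?_⟩
      · simp only [Pi.sub_apply]; linarith
      · simp only [Pi.sub_apply]; linarith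
      · funext i; simp
    · rintro ⟨x, ⟨h1, h2⟩, rfl⟩
      simp only [Pi.sub_apply]
      constructor <;> linarith
  · intro x _
    rw [hri, hr'i, det_eq_apply]
    simp

/-- **The witness pair is KZ-equivalent by three moves.** If `R₁ = [(1,2), 1]`,
`Rg = [(1,2), 1 + 1/x − 1/(3−x)]`, `Rd = [(1,2), 1/x − 1/(3−x)]`, `Rh = [(1,2), 1/x]`,
`Rk = [(1,2), 1/(3−x)]`, then `[R₁] − [Rg] = −ρ₁ − ρ₃ + ρ₂` with `ρ₁ = [Rg] − [R₁] − [Rd]`,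
`ρ₂ = [Rh] − [Rd] − [Rk]` (rule 1b) and `ρ₃ = [Rh] − [Rk]` (the reflection), so
`Equivalent R₁ Rg`. [Kontsevich–Zagier 2001, §1.2] [folklore] -/
theorem equivalent_of_reps {R₁ Rg Rd Rh Rk : KZ.IntegralRep 1}
    (h₁d : R₁.domain = ((fun x : Fin 1 → ℝ => x 0) ⁻¹' Ioo 1 2)) (h₁i : ∀ x, R₁.integrand x = 1)
    (hgd : Rg.domain = ((fun x : Fin 1 → ℝ => x 0) ⁻¹' Ioo 1 2))
    (hgi : ∀ x, Rg.integrand x = 1 + 1 / x 0 - 1 / (3 - x 0))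
    (hdd : Rd.domain = ((fun x : Fin 1 → ℝ => x 0) ⁻¹' Ioo 1 2))
    (hdi : ∀ x, Rd.integrand x = 1 / x 0 - 1 / (3 - x 0))
    (hhd : Rh.domain = ((fun x : Fin 1 → ℝ => x 0) ⁻¹' Ioo 1 2))
    (hhi : ∀ x, Rh.integrand x = 1 / x 0)
    (hkd : Rk.domain = ((fun x : Fin 1 → ℝ => x 0) ⁻¹' Ioo 1 2))
    (hki : ∀ x, Rk.integrand x = 1 / (3 - x 0)) :
    KZ.Equivalent R₁ Rg := by
  have ρ₁ : KZ.of Rg - KZ.of R₁ - KZ.of Rd ∈ KZ.relations :=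
    KZ.integrandAddRel_subset_relations (sub_sub_mem_integrandAddRel (h₁d.trans hgd.symm)
      (hdd.trans hgd.symm) fun x _ => by rw [hgi, h₁i, hdi]; ring)
  have ρ₂ : KZ.of Rh - KZ.of Rd - KZ.of Rk ∈ KZ.relations :=
    KZ.integrandAddRel_subset_relations (sub_sub_mem_integrandAddRel (hdd.trans hhd.symm)
      (hkd.trans hhd.symm) fun x _ => by rw [hhi, hdi, hki]; ring)
  have ρ₃ : KZ.of Rh - KZ.of Rk ∈ KZ.relations :=
    KZ.changeOfVariablesRel_subset_relations (reflection_mem_changeOfVariablesRel hhd hkd hhi hki)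
  unfold KZ.Equivalent
  have : KZ.of R₁ - KZ.of Rg = -(KZ.of Rg - KZ.of R₁ - KZ.of Rd) - (KZ.of Rh - KZ.of Rk)
      + (KZ.of Rh - KZ.of Rd - KZ.of Rk) := by abel
  rw [this]
  exact KZ.relations.add_mem (KZ.relations.sub_mem (KZ.relations.neg_mem ρ₁) ρ₃) ρ₂

/-! ## §3 No same-dimension transport between full-measure restrictions -/

/-- **The log obstruction.** For `r = [(1,2), 1]` and `r' = [(1,2), 1 + 1/x − 1/(3−x)]` and any
full-measure `ℚ`-semialgebraic restrictions `s ⊆ r`, `s' ⊆ r'` (integrands inherited),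
`[s] − [s']` is NOT a change-of-variables move: such a move would be (free-group pinning, `s ≠ s'`
as the integrands agree only at `3/2`) an injective `ℚ`-semialgebraic `Φ` on `s.domain` with
`1 = g(Φ x)|Φ' x|`; on an open interval inside `s.domain` the sign of `Φ'` is constant (Darboux),
`(−Φ²+Φ+3)Φ' = εΦ(3−Φ)`, and the swapped simple-pole descent kills the non-zero polynomial
relation `P(Φ t, t) = 0` supplied by semialgebraicity (`log` is not semialgebraic).
[Kontsevich–Zagier 2001, §1.2, rule (2)] [folklore] -/
theorem not_mem_changeOfVariablesRel {r r' : KZ.IntegralRep 1}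
    (hr : r.domain = ((fun x : Fin 1 → ℝ => x 0) ⁻¹' Ioo 1 2)) (hri : ∀ x, r.integrand x = 1)
    (hr' : r'.domain = ((fun x : Fin 1 → ℝ => x 0) ⁻¹' Ioo 1 2))
    (hr'i : ∀ x, r'.integrand x = 1 + 1 / x 0 - 1 / (3 - x 0))
    (s s' : KZ.IntegralRep 1) (hsS : s.domain ⊆ r.domain)
    (hsnull : volume (r.domain \ s.domain) = 0) (hsint : EqOn s.integrand r.integrand s.domain)
    (hs'S : s'.domain ⊆ r'.domain) (hs'int : EqOn s'.integrand r'.integrand s'.domain) :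
    KZ.of s - KZ.of s' ∉ KZ.changeOfVariablesRel := by
  rw [hr] at hsS hsnull
  rw [hr'] at hs'S
  rintro ⟨n, ρ, ρ', Φ, Φ', hsa, hder, hinj, hdom, hcov, heq⟩
  -- `s.domain` has non-zero measure
  have hvolS : volume s.domain ≠ 0 := by
    intro h0
    apply volume_I12_ne_zero
    have hsub : ((fun x : Fin 1 → ℝ => x 0) ⁻¹' Ioo 1 2) ⊆
        s.domain ∪ (((fun x : Fin 1 → ℝ => x 0) ⁻¹' Ioo 1 2) \ s.domain) := fun x hx => by
      by_cases h : x ∈ s.domain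
      · exact Or.inl h
      · exact Or.inr ⟨hx, h⟩
    exact measure_mono_null hsub (measure_union_null h0 hsnull)
  -- `s ≠ s'`: the two integrands agree only at `x = 3/2`
  have hne : (⟨1, s⟩ : Σ k, KZ.IntegralRep k) ≠ ⟨1, s'⟩ := by
    intro e
    have hss' : s = s' := eq_of_heq (Sigma.mk.inj_iff.mp e).2
    apply hvolS
    have hsub : s.domain ⊆ {fun _ : Fin 1 => (3 / 2 : ℝ)} := by
      intro x hx
      have h1 : s.integrand x = 1 := (hsint hx).trans (hri x)
      have hx' : x ∈ s'.domain := hss' ▸ hx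
      have h2 : s'.integrand x = 1 + 1 / x 0 - 1 / (3 - x 0) := (hs'int hx').trans (hr'i x)
      rw [← hss', h1] at h2
      have hxI := hsS hx
      obtain ⟨ha, hb⟩ : (x 0 : ℝ) ≠ 0 ∧ (3 : ℝ) - x 0 ≠ 0 := ⟨by linarith [hxI.1], by linarith [hxI.2]⟩
      have h3 : x 0 = 3 / 2 := by
        field_simp at h2
        linarith
      rw [mem_singleton_iff, KZ.eq_const_apply_zero x, h3]
    exact measure_mono_null hsub (measure_singleton _)
  obtain ⟨e₁, e₂⟩ := eq_of_of_sub_of_eq hne heq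
  cases e₁
  cases e₂
  -- an open interval inside `s.domain`; the one-variable avatar `φ` of `Φ`, its derivative `φ'`
  obtain ⟨p, q, hpq, hI⟩ := exists_Ioo_subset_of_volume_ne_zero s.isSemialgebraic_domain hvolS
  set φ : ℝ → ℝ := fun t => Φ (fun _ => t) 0 with hφ
  set φ' : ℝ → ℝ := fun t => Φ' (fun _ => t) (fun _ => 1) 0 with hφ'
  have hnhds : ∀ t ∈ Ioo p q, s.domain ∈ 𝓝 (fun _ : Fin 1 => t) := by
    intro t ht
    have hU : IsOpen {z : Fin 1 → ℝ | z 0 ∈ Ioo p q} := isOpen_Ioo.preimage (continuous_apply 0)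
    refine mem_of_superset (hU.mem_nhds ht) fun z hz => ?_
    rw [KZ.eq_const_apply_zero z]
    exact hI (z 0) hz
  have hderiv : ∀ t ∈ Ioo p q, HasDerivAt φ (φ' t) t := by
    intro t ht
    have hF : HasFDerivAt Φ (Φ' fun _ => t) (fun _ => t) :=
      (hder _ (hI t ht)).hasFDerivAt (hnhds t ht)
    have hι : HasDerivAt (fun u : ℝ => (fun _ : Fin 1 => u)) (fun _ : Fin 1 => (1 : ℝ)) t :=
      hasDerivAt_pi.mpr fun _ => hasDerivAt_id' t
    exact (hasDerivAt_pi.mp (hF.comp_hasDerivAt t hι)) 0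
  have hφmem : ∀ t ∈ Ioo p q, 1 < φ t ∧ φ t < 2 := by
    intro t ht
    have hx' : Φ (fun _ => t) ∈ s'.domain := by
      rw [hdom]
      exact mem_image_of_mem Φ (hI t ht)
    exact hs'S hx'
  have hid : ∀ t ∈ Ioo p q, 1 = (1 + 1 / φ t - 1 / (3 - φ t)) * |φ' t| := by
    intro t ht
    have hx := hI t ht
    have h := hcov _ hx
    have h1 : s.integrand (fun _ => t) = 1 := (hsint hx).trans (hri _)
    have hx' : Φ (fun _ => t) ∈ s'.domain := by
      rw [hdom]
      exact mem_image_of_mem Φ hx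
    have h2 : s'.integrand (Φ fun _ => t) = 1 + 1 / φ t - 1 / (3 - φ t) :=
      (hs'int hx').trans (hr'i _)
    rw [h1, h2, det_eq_apply, single_eq_one] at h
    exact h
  -- the sign of `φ'` is constant (Darboux), so `g(φ) φ' = ε`
  have hne0 : ∀ t ∈ Ioo p q, φ' t ≠ 0 := by
    intro t ht h0
    have := hid t ht
    rw [h0, abs_zero, mul_zero] at this
    exact one_ne_zero this
  obtain ⟨ε, hε, hεid⟩ : ∃ ε : ℝ, (ε = 1 ∨ ε = -1) ∧
      ∀ t ∈ Ioo p q, (1 + 1 / φ t - 1 / (3 - φ t)) * φ' t = ε := by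
    rcases hasDerivWithinAt_forall_lt_or_forall_gt_of_forall_ne (convex_Ioo p q)
      (fun t ht => (hderiv t ht).hasDerivWithinAt) hne0 with hneg | hpos
    · refine ⟨-1, Or.inr rfl, fun t ht => ?_⟩
      have := hid t ht
      rw [abs_of_neg (hneg t ht), mul_neg] at this
      linarith
    · refine ⟨1, Or.inl rfl, fun t ht => ?_⟩
      have := hid t ht
      rw [abs_of_pos (hpos t ht)] at this
      exact this.symm
  -- polynomial form: `N(φ) φ' = (φ − 0) V(φ)` with `N = −X² + X + 3`, `V = ε (3 − X)`
  have hDN : ∀ t ∈ Ioo p q,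
      (-(Polynomial.X : Polynomial ℝ) ^ 2 + Polynomial.X + Polynomial.C 3).eval (φ t) * φ' t =
        ((Polynomial.X - Polynomial.C 0) *
          (Polynomial.C ε * (Polynomial.C 3 - Polynomial.X))).eval (φ t) := by
    intro t ht
    obtain ⟨hy1, hy2⟩ := hφmem t ht
    obtain ⟨hy0, hy3⟩ : φ t ≠ 0 ∧ 3 - φ t ≠ 0 := ⟨by linarith, by linarith⟩
    have key := hεid t ht
    have e1 : (1 + 1 / φ t - 1 / (3 - φ t)) * (φ t * (3 - φ t)) = -(φ t) ^ 2 + φ t + 3 := by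
      field_simp
      ring
    have e2 : (-(φ t) ^ 2 + φ t + 3) * φ' t = ε * (φ t * (3 - φ t)) := by
      rw [← e1, ← key]
      ring
    simp only [Polynomial.eval_mul, Polynomial.eval_add, Polynomial.eval_neg,
      Polynomial.eval_pow, Polynomial.eval_sub, Polynomial.eval_X, Polynomial.eval_C]
    linear_combination e2
  -- the polynomial relation supplied by semialgebraicity of `Φ`
  have hsaF : IsSemialgebraicFunOn ℚ s.domain (fun x => Φ x 0) := by
    unfold IsSemialgebraicFunOn
    simpa only [IsSemialgebraicMapOn, Fin.append_right_eq_snoc] using hsa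
  obtain ⟨P, hP0, hPv⟩ := exists_ne_zero_evalEval_swap_eq_zero hsaF
  have hPv' : ∀ t ∈ Ioo p q, P.evalEval (φ t) t = 0 := fun t ht => hPv _ (hI t ht)
  have hinjφ : InjOn φ (Ioo p q) := by
    intro t₁ h₁ t₂ h₂ h12
    have hΦ : Φ (fun _ => t₁) = Φ (fun _ => t₂) := by
      rw [KZ.eq_const_apply_zero (Φ fun _ => t₁), KZ.eq_const_apply_zero (Φ fun _ => t₂)]
      exact congrArg (fun (c : ℝ) (_ : Fin 1) => c) h12
    exact congrFun (hinj (hI t₁ h₁) (hI t₂ h₂) hΦ) 0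
  have hV : (Polynomial.C ε * (Polynomial.C 3 - Polynomial.X) : Polynomial ℝ).eval 0 ≠ 0 := by
    simp only [Polynomial.eval_mul, Polynomial.eval_C, Polynomial.eval_sub, Polynomial.eval_X,
      sub_zero]
    rcases hε with rfl | rfl <;> norm_num
  have hN : (-(Polynomial.X : Polynomial ℝ) ^ 2 + Polynomial.X + Polynomial.C 3).eval 0 ≠ 0 := by
    simp
  exact hP0 (eq_zero_of_evalEval_swap_eq_zero hpq hderiv hDN hV hN hinjφ P.natDegree P le_rfl
    hPv')

/-! ## §4 The route declaration -/

/-- **Settles stmt-KontsevichZagierPeriods-2671 (`DimOneTransportFails`): stabilisation is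
necessary.** The rational, positive pair `r = [(1,2), 1]`, `r' = [(1,2), 1 + 1/x − 1/(3 − x)]` is
KZ-equivalent by three honest moves (rule 1b twice and the reflection `y = 3 − x`), yet for no
full-measure `ℚ`-semialgebraic restrictions `s ⊆ r`, `s' ⊆ r'` with the inherited integrands is
`[s] − [s']` a single change-of-variables move: the transport map would invert
`y ↦ ±(y + log y + log (3 − y)) + c`, and `log` is not semialgebraic (swapped simple-pole descent).
So the same-dimension (density) form of the route's thesis fails in dimension `1` and the free
dimension `M ≥ 1` of `StableSetTransport` is load-bearing. [Kontsevich–Zagier 2001, §1.2;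
Cresson–Viu-Sos 2022, §2.1–2.2] [folklore] -/
theorem dimOneTransportFails_proof :
    Summit.KontsevichZagierPeriods.KontsevichZagierPeriods.Theses.ScissorsTransport.DimOneTransportFails := by
  unfold Summit.KontsevichZagierPeriods.KontsevichZagierPeriods.Theses.ScissorsTransport.DimOneTransportFails
  obtain ⟨R₁, h₁d, h₁i⟩ := exists_lineRep (fun _ => (1 : ℝ))
    (by simpa using isSemialgebraicFunOn_ratCast isSemialgebraic_I12 1) continuousOn_const
  obtain ⟨Rg, hgd, hgi⟩ := exists_lineRep (fun y => 1 + 1 / y - 1 / (3 - y)) sa_g continuousOn_g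
  obtain ⟨Rd, hdd, hdi⟩ := exists_lineRep (fun y => 1 / y - 1 / (3 - y)) sa_d continuousOn_d
  obtain ⟨Rh, hhd, hhi⟩ := exists_lineRep (fun y => 1 / y) sa_h continuousOn_h
  obtain ⟨Rk, hkd, hki⟩ := exists_lineRep (fun y => 1 / (3 - y)) sa_k continuousOn_k
  refine ⟨R₁, Rg, ?_, ?_, fun x _ => by rw [h₁i]; exact one_pos, fun x hx => ?_,
    equivalent_of_reps h₁d h₁i hgd hgi hdd hdi hhd hhi hkd hki,
    fun s s' hsS hsnull hsint hs'S _ hs'int =>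
      not_mem_changeOfVariablesRel h₁d h₁i hgd hgi s s' hsS hsnull hsint hs'S hs'int⟩
  · refine ⟨1, 1, fun x _ => by simp, fun x _ => ?_⟩
    simp [h₁i]
  · refine ⟨-(X 0) ^ 2 + X 0 + 3, X 0 * (3 - X 0), fun x hx => ?_, fun x hx => ?_⟩
    · rw [hgd] at hx
      obtain ⟨ha, hb⟩ : (0 : ℝ) < x 0 ∧ (0 : ℝ) < 3 - x 0 := ⟨by linarith [hx.1], by linarith [hx.2]⟩
      simp only [map_mul, map_sub, aeval_X, map_ofNat]
      positivity
    · rw [hgd] at hx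
      obtain ⟨ha, hb⟩ : (x 0 : ℝ) ≠ 0 ∧ (3 : ℝ) - x 0 ≠ 0 := ⟨by linarith [hx.1], by linarith [hx.2]⟩
      rw [hgi]
      simp only [map_mul, map_sub, map_add, map_neg, map_pow, aeval_X, map_ofNat]
      field_simp
      ring
  · rw [hgd] at hx
    rw [hgi]
    exact g_pos hx.1 hx.2

end Summit.KontsevichZagierPeriods.ScissorsTransport
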